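import Literature.MathematicalPhysics.QuantumLattice.TorusWilsonFlowContinuity
import Summits.QuantumFields.YangMills.Theorems.ParabolicTrajectoryContinuumLimitOnTrajectoryFlowDefs

/-!
# Stub `stub_flowContinuity` (line curtiss-flowed-free-energies of crux `ContinuumLimitOnTrajectory`) PROVED

Route `ParabolicTrajectory`, crux `ContinuumLimitOnTrajectory` (stmt-QuantumFields-10522), line
`curtiss-flowed-free-energies`, registered stub `stub_flowContinuity : Statement.stub_flowContinuity`
(= `BoundedFlowedEnergyContinuous`): for every compact group `G`, every faithful continuous unitary
lattice representation `r`, every torus side `S ≥ 1`, every flow time `t ≥ 0` and every site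
`x ∈ ℤ⁴`, the bounded Wilson-flowed action density of the periodic lift,
`U ↦ boundedFlowedEnergy r.ρ t x (torusLift S U)`, is continuous on `GaugeConfig 4 S G`.
A one-line instance of the Literature theorem
`Literature.MathematicalPhysics.QuantumLattice.continuous_boundedFlowedEnergy_torusLift`
(global existence of Lüscher's torus flow line for unitary data through any unitary `ρ`,
unitarity along the flow, Lipschitz dependence on the data; `TorusWilsonFlowExistence.lean`,
`TorusWilsonFlowContinuity.lean`), which holds for every real `t` and every dimension `d`.
-/

namespace Summit.QuantumFields.YangMills.Cruxes.ContinuumLimitOnTrajectory.CurtissFlowedFreeEnergies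

/-- REGISTERED STUB `stub_flowContinuity` of line `curtiss-flowed-free-energies` (crux
`ContinuumLimitOnTrajectory`, stmt-QuantumFields-10522): continuity of the torus Wilson-flowed
action density in the configuration, `BoundedFlowedEnergyContinuous` — an instance (`d = 4`,
`ρ = r.ρ`) of `continuous_boundedFlowedEnergy_torusLift` (Lüscher 2010, §1 p. 2). -/
theorem stub_flowContinuity : Statement.stub_flowContinuity :=
  fun _ _ _ _ _ r S _ t _ x =>
    Literature.MathematicalPhysics.QuantumLattice.continuous_boundedFlowedEnergy_torusLift
      r.ρ r.continuous r.mem_unitary S t x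

end Summit.QuantumFields.YangMills.Cruxes.ContinuumLimitOnTrajectory.CurtissFlowedFreeEnergies
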